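import Summits.CriticalPhenomena.PercolationContinuityZ3.Theorems.PercNearOneGluingNoHeavyLowerTailCILTwoPortLevelTwoTools
import Summits.CriticalPhenomena.PercolationContinuityZ3.Theorems.PercNearOneGluingNoHeavyLowerTailCILStrongRelayNeighbours
import HarnessLib

/-!
# `NoHeavyLowerTail` (stmt-CriticalPhenomena-4575) — the two-sided core of the hull-port residual with a TWO-PORT star, at levels `j ≤ 2`

Support file (prover `prim-hp-2`, deletion–contraction / pivotal-edge line; `--supports stmt-CriticalPhenomena-4575`).
No definitions, no named facts, no sorries.

Notation: `μ_w = prodBernoulli w` on `Fin n`, relays `A`, level `j`, `π(v) = {z ∈ A : v ↔ z}`, `π(S) = ⋃_{v∈S} π(v)`, lightness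
`I_w(x) = μ_w{|π(x)| ≤ j}`, `CS_w(S, i) : μ_w(i ↮ S, 1 ≤ |π(S)| ≤ j) ≤ μ_w(i ↮ S, |π(i)| ≤ j)` (as in `observerSet_le_of_lonelier`).
The TWO-SIDED CORE of the hull-port residual (`…CILTwoPendantStars` = TPS, `HullPort.setCS_pair_of_oneSided`, crux notes of
prim-hp-1/2/3/5/6): `CS_H({s₁,s₂}, i)` for two non-adjacent non-relays `s₁, s₂` whose positive-weight neighbours are relays (their PORTS) and
a relay `i` dominating the ports IN `H` ITSELF.  Proved classes so far: one-sided references (a star with ONE port, or domination after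
deleting one star).  THIS FILE proves the first genuinely two-sided class:

* `setCS_pair_twoPort_levelTwo` — **if `s₂` has exactly two ports `c ≠ d`, `i ∉ {c,d}` dominates every port of `s₁` and `c, d` in the
  graph itself, and `j ≤ 2`, then `CS_w({s₁,s₂}, i)`** — for ANY number of ports of `s₁` and any graph elsewhere.  With the own-edge
  stability of the champion (`CutObserver.champion_of_erase_own_edge`, which removes the witness's own star edges) this settles, at the
  crux's `(5,2)` rung, the two-pendant-stars observer (`cil_twoPendantStars_of_TPS`) for every port shape in which one star has two ports.

Proof (crux notes of prim-hp-2, TPS-P2EQ2.md §1–§4; every step is an exact pivotal decomposition plus one exchange inequality):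
(1) `setCS_pair_of_hyperedgeDD`: it suffices that the HYPEREDGE inequality `DD = (1−Y) f_∅ + Y f_{cd} ≥ 0` holds (`Y = y_c y_d`);
(2) work in `u = w[s₂c ↦ 1, s₂d ↦ Y]` (same relay lightnesses, `Hyperedge.lightness_eq_of_sameGlue`; same configuration off `s₂`);
(3) `Hyperedge.levelTwo_compare` (`j ≤ 2`): `DD ≥ CSdiff_u({s₁}, i) − Y·μ(Z)·μ(V_K)`;
(4) `Hyperedge.levelTwo_slack` (strong CIL `lightnessSlack_relayNeighbours` for the best gate in `u ∖ s₁`, which `i` dominates):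
    `CSdiff_u({s₁}, i) = I_u(i) − μ_u{1 ≤ |π(s₁)| ≤ j} ≥ μ(Z)·Y·μ(V_K)`.
Only (3) uses `j ≤ 2` (a relay joined to the glued block `{c,d}` sees three relays); for `j ≥ 3` the hyperedge inequality is open
(0 violations numerically; ttrl2 request `tps-hyperedge-dd`).
-/

noncomputable section

namespace Summit.CriticalPhenomena.PercolationContinuityZ3.Theorems

open MeasureTheory Set Literature.Probability.LatticeModels Literature.Probability.Percolation
open scoped Classical BigOperators

variable {n : ℕ}

namespace Hyperedge

open CutObserver KNPreFKG

/-- **The lightness slack with a glued two-port vertex.**  `u(s₂c) = 1`, the positive-weight pairs at `s₂` end in `c` or `d`, every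
positive-weight neighbour of `s₁ ∉ A` is a listed relay `p l`, `c` is listed, and `i` dominates every listed relay in `u`.  Then
`μ{Z}·(u(s₂d)·μ{V_K}) ≤ I_u(i) − μ_u{1 ≤ |π(s₁)| ≤ j}` with `Z = {∀ l, s₁–p l closed}` and `V_K = {|π_K(c) ∪ π_K(d)| ≤ j}` read off
`s₁` and `s₂`.  [cite: VandenbergHaggstromKahn2005, Thm. 1.5 (p. 7) — via `lightnessSlack_relayNeighbours`] -/
theorem levelTwo_slack (u : Sym2 (Fin n) → unitInterval) (A : Finset (Fin n)) (s₁ s₂ c d i : Fin n) (j : ℕ) {m : ℕ}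
    (p : Fin m → Fin n) (hp : Function.Injective p) (hpA : ∀ l, p l ∈ A) (hs₁A : s₁ ∉ A) (hs₂A : s₂ ∉ A) (h12 : s₁ ≠ s₂)
    (hcd : c ≠ d) (hdA : d ∈ A) (hobs₁ : ∀ v, u s(s₁, v) ≠ 0 → ∃ l, v = p l) (hc : ∃ l, p l = c)
    (hobs₂ : ∀ v, v ≠ s₂ → u s(s₂, v) ≠ 0 → v = c ∨ v = d) (huc : u s(s₂, c) = 1)
    (hdom : ∀ l : Fin m, (prodBernoulli u).real {ω : BondConfig (Fin n) | (A.filter fun z => ω ∈ openConn (p l) z).card ≤ j} ≤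
      (prodBernoulli u).real {ω : BondConfig (Fin n) | (A.filter fun z => ω ∈ openConn i z).card ≤ j}) :
    (prodBernoulli u).real {ω : BondConfig (Fin n) | ∀ l, s(s₁, p l) ∉ ω} *
        ((u s(s₂, d) : ℝ) * (prodBernoulli u).real {ω : BondConfig (Fin n) |
          (A.filter fun z => (openGraph ((ω ∩ {e | s₁ ∉ e}) ∩ {e | s₂ ∉ e})).Reachable c z ∨
            (openGraph ((ω ∩ {e | s₁ ∉ e}) ∩ {e | s₂ ∉ e})).Reachable d z).card ≤ j}) ≤
      (prodBernoulli u).real {ω : BondConfig (Fin n) | (A.filter fun z => ω ∈ openConn i z).card ≤ j} -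
        (prodBernoulli u).real {ω : BondConfig (Fin n) |
          1 ≤ (A.filter fun z => ω ∈ openConn s₁ z).card ∧ (A.filter fun z => ω ∈ openConn s₁ z).card ≤ j} := by
  haveI : ∀ v : Sym2 (Fin n) → unitInterval, IsProbabilityMeasure (prodBernoulli v) := fun v => inferInstance
  obtain ⟨lc, hlc⟩ := hc
  have hcA : c ∈ A := hlc ▸ hpA lc
  have hcs : c ≠ s₂ := fun h => hs₂A (h ▸ hcA)
  have hds : d ≠ s₂ := fun h => hs₂A (h ▸ hdA)
  have hc1 : c ≠ s₁ := fun h => hs₁A (h ▸ hcA)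
  -- `H`-lightness (off `s₁`) of the listed relays and its maximiser
  set H : Fin m → ℝ := fun l => (prodBernoulli u).real {ω : BondConfig (Fin n) |
    (A.filter fun z => (openGraph (ω ∩ {e | s₁ ∉ e})).Reachable (p l) z).card ≤ j} with hH
  obtain ⟨iz, -, hiz⟩ := Finset.exists_max_image Finset.univ H ⟨lc, Finset.mem_univ _⟩
  have hslack := lightnessSlack_relayNeighbours u A s₁ j p hp hpA hs₁A hobs₁ iz (fun l => hiz l (Finset.mem_univ _))
  -- the `H`-lightness of `c` is at least `u(s₂d)·μ(V_K)`: star expansion at `s₂` in `u ∖ s₁`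
  set u' : Sym2 (Fin n) → unitInterval := fun e => if e ∈ {e : Sym2 (Fin n) | s₁ ∉ e} then u e else 0 with hu'
  have hu'le : ∀ e, u' e ≠ 0 → u e ≠ 0 := by
    intro e he h
    apply he
    simp only [hu']
    split_ifs
    · exact h
    · rfl
  have hu'c : u' s(s₂, c) = 1 := by
    have : s₁ ∉ s(s₂, c) := by rw [Sym2.mem_iff, not_or]; exact ⟨h12, hc1.symm⟩
    simp only [hu', mem_setOf_eq, this, not_false_eq_true, if_true, huc]
  have hobs₂' : ∀ v, v ≠ s₂ → u' s(s₂, v) ≠ 0 → v = c ∨ v = d := fun v hv h => hobs₂ v hv (hu'le _ h)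
  set P : Finset (Fin n) := {c, d} with hP
  have hs₂P : s₂ ∉ P := by simp [hP, hcs.symm, hds.symm]
  have hobsP : ∀ y, y ≠ s₂ → y ∉ P → u' s(s₂, y) = 0 := by
    intro y hy hyP
    by_contra h
    rcases hobs₂' y hy h with rfl | rfl <;> simp [hP] at hyP
  have hHc : H lc = (prodBernoulli u').real {ω : BondConfig (Fin n) | (A.filter fun z => ω ∈ openConn c z).card ≤ j} := by
    have h : (prodBernoulli u).real {ω : BondConfig (Fin n) | ω ∩ {e | s₁ ∉ e} ∈
        {ω : BondConfig (Fin n) | (A.filter fun z => ω ∈ openConn c z).card ≤ j}} =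
        (prodBernoulli u').real {ω : BondConfig (Fin n) | (A.filter fun z => ω ∈ openConn c z).card ≤ j} :=
      measureReal_preimage_avoid u s₁ {ω : BondConfig (Fin n) | (A.filter fun z => ω ∈ openConn c z).card ≤ j}
    rw [← h]
    simp only [hH, hlc]
    congr 1
    ext ω
    simp only [mem_setOf_eq, filter_avoid_eq]
  have hexp := lightness_star_expansion u' A s₂ c P j hs₂A hcA hs₂P hobsP
  -- the `B = {c,d}` term
  set g : Finset (Fin n) → BondConfig (Fin n) → Prop := fun B ξ =>
    (A.filter fun z => (openGraph ξ).Reachable c z ∨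
      ((∃ b ∈ B, (openGraph ξ).Reachable b c) ∧ ∃ b' ∈ B, (openGraph ξ).Reachable b' z)).card ≤ j with hg
  have hterm : (prodBernoulli u').real (starEvent s₂ (↑P : Set (Fin n))) *
      (prodBernoulli u').real {ω | g P (ω ∩ {e | s₂ ∉ e})} ≤
      (prodBernoulli u').real {ω : BondConfig (Fin n) | (A.filter fun z => ω ∈ openConn c z).card ≤ j} := by
    rw [hexp]
    refine Finset.single_le_sum (f := fun B : Finset (Fin n) => (prodBernoulli u').real (starEvent s₂ (↑B : Set (Fin n))) *
      (prodBernoulli u').real {ω | g B (ω ∩ {e | s₂ ∉ e})}) (fun B _ => mul_nonneg measureReal_nonneg measureReal_nonneg)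
      (Finset.mem_powerset.2 (subset_refl P))
  have hσP : (prodBernoulli u').real (starEvent s₂ (↑P : Set (Fin n))) = (u s(s₂, d) : ℝ) := by
    rw [hP, (measureReal_starEvent_twoPort_cases u' s₂ c d hcs hds hcd hobs₂').2.2.2, hu'c]
    have : s₁ ∉ s(s₂, d) := by
      rw [Sym2.mem_iff, not_or]; exact ⟨h12, fun h => hs₁A (h ▸ hdA)⟩
    simp only [hu', mem_setOf_eq, this, not_false_eq_true, if_true, Set.Icc.coe_one, one_mul]
  -- identify the `g P` event with `V_K`
  have hgV : (prodBernoulli u').real {ω | g P (ω ∩ {e | s₂ ∉ e})} =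
      (prodBernoulli u).real {ω : BondConfig (Fin n) |
          (A.filter fun z => (openGraph ((ω ∩ {e | s₁ ∉ e}) ∩ {e | s₂ ∉ e})).Reachable c z ∨
            (openGraph ((ω ∩ {e | s₁ ∉ e}) ∩ {e | s₂ ∉ e})).Reachable d z).card ≤ j} := by
    have hev : {ω : BondConfig (Fin n) | g P (ω ∩ {e | s₂ ∉ e})} = {ξ : BondConfig (Fin n) |
        (A.filter fun z => (openGraph (ξ ∩ {e | s₂ ∉ e})).Reachable c z ∨
          (openGraph (ξ ∩ {e | s₂ ∉ e})).Reachable d z).card ≤ j} := by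
      ext ω
      simp only [hg, mem_setOf_eq]
      have : (A.filter fun z => (openGraph (ω ∩ {e | s₂ ∉ e})).Reachable c z ∨
          ((∃ b ∈ P, (openGraph (ω ∩ {e | s₂ ∉ e})).Reachable b c) ∧ ∃ b' ∈ P, (openGraph (ω ∩ {e | s₂ ∉ e})).Reachable b' z)) =
          (A.filter fun z => (openGraph (ω ∩ {e | s₂ ∉ e})).Reachable c z ∨ (openGraph (ω ∩ {e | s₂ ∉ e})).Reachable d z) := by
        refine Finset.filter_congr fun z _ => ⟨?_, ?_⟩
        · rintro (h | ⟨-, ⟨b', hb', hb'z⟩⟩)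
          · exact Or.inl h
          · rw [hP, Finset.mem_insert, Finset.mem_singleton] at hb'
            rcases hb' with rfl | rfl
            · exact Or.inl hb'z
            · exact Or.inr hb'z
        · rintro (h | h)
          · exact Or.inl h
          · exact Or.inr ⟨⟨c, by simp [hP], SimpleGraph.Reachable.refl _⟩, ⟨d, by simp [hP], h⟩⟩
      rw [this]
    rw [hev]
    have h2 : (prodBernoulli u).real {ω : BondConfig (Fin n) | ω ∩ {e | s₁ ∉ e} ∈ {ξ : BondConfig (Fin n) |
        (A.filter fun z => (openGraph (ξ ∩ {e | s₂ ∉ e})).Reachable c z ∨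
          (openGraph (ξ ∩ {e | s₂ ∉ e})).Reachable d z).card ≤ j}} = (prodBernoulli u').real {ξ : BondConfig (Fin n) |
        (A.filter fun z => (openGraph (ξ ∩ {e | s₂ ∉ e})).Reachable c z ∨
          (openGraph (ξ ∩ {e | s₂ ∉ e})).Reachable d z).card ≤ j} :=
      measureReal_preimage_avoid u s₁ _
    rw [← h2]
    rfl
  -- assemble
  have hHc' : (u s(s₂, d) : ℝ) * (prodBernoulli u).real {ω : BondConfig (Fin n) |
          (A.filter fun z => (openGraph ((ω ∩ {e | s₁ ∉ e}) ∩ {e | s₂ ∉ e})).Reachable c z ∨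
            (openGraph ((ω ∩ {e | s₁ ∉ e}) ∩ {e | s₂ ∉ e})).Reachable d z).card ≤ j} ≤ H iz := by
    have h1 : H lc ≤ H iz := hiz lc (Finset.mem_univ _)
    rw [← hσP, ← hgV]
    exact (hterm.trans (hHc ▸ h1))
  have hZ : 0 ≤ (prodBernoulli u).real {ω : BondConfig (Fin n) | ∀ l, s(s₁, p l) ∉ ω} := measureReal_nonneg
  have := mul_le_mul_of_nonneg_left hHc' hZ
  linarith [hdom iz, hslack]

end Hyperedge

open CutObserver KNPreFKG Hyperedge in
/-- **The two-sided core with a two-port star at levels `j ≤ 2`.**  Let `s₁ ≠ s₂` be non-relays, every positive-weight pair at `s₁`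
ending in a relay and every positive-weight pair at `s₂` ending in one of two relays `c ≠ d`; let `i ∈ A ∖ {c, d}` satisfy
`I_w(a) ≤ I_w(i)` for every port `a` of `s₁` and for `a ∈ {c, d}` (lightness in the graph itself), and let `j ≤ 2`.  Then
`CS_w({s₁,s₂}, i)`: `μ_w(i ↮ {s₁,s₂}, 1 ≤ |π({s₁,s₂})| ≤ j) ≤ μ_w(i ↮ {s₁,s₂}, |π(i)| ≤ j)`.
[cite: VandenbergHaggstromKahn2005, Thm. 1.5 (p. 7) — via `observerSet_le_of_lonelier` and `lightnessSlack_relayNeighbours`] -/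
theorem setCS_pair_twoPort_levelTwo (w : Sym2 (Fin n) → unitInterval) (A : Finset (Fin n)) (s₁ s₂ c d i : Fin n) (j : ℕ)
    (hj : j ≤ 2) (hs₁A : s₁ ∉ A) (hs₂A : s₂ ∉ A) (h12 : s₁ ≠ s₂) (hcA : c ∈ A) (hdA : d ∈ A) (hcd : c ≠ d) (hiA : i ∈ A)
    (hic : i ≠ c) (hid : i ≠ d) (hobs₁ : ∀ v, w s(s₁, v) ≠ 0 → v ∈ A) (hobs₂ : ∀ v, v ≠ s₂ → w s(s₂, v) ≠ 0 → v = c ∨ v = d)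
    (hdom : ∀ a ∈ A, (w s(s₁, a) ≠ 0 ∨ a = c ∨ a = d) →
      (prodBernoulli w).real {ω : BondConfig (Fin n) | (A.filter fun z => ω ∈ openConn a z).card ≤ j} ≤
        (prodBernoulli w).real {ω : BondConfig (Fin n) | (A.filter fun z => ω ∈ openConn i z).card ≤ j}) :
    (prodBernoulli w).real {ω : BondConfig (Fin n) | (∀ x ∈ ({s₁, s₂} : Finset (Fin n)), ω ∉ openConn i x) ∧
        1 ≤ (A.filter fun z => ∃ x ∈ ({s₁, s₂} : Finset (Fin n)), ω ∈ openConn x z).card ∧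
        (A.filter fun z => ∃ x ∈ ({s₁, s₂} : Finset (Fin n)), ω ∈ openConn x z).card ≤ j} ≤
      (prodBernoulli w).real {ω : BondConfig (Fin n) | (∀ x ∈ ({s₁, s₂} : Finset (Fin n)), ω ∉ openConn i x) ∧
        (A.filter fun z => ω ∈ openConn i z).card ≤ j} := by
  haveI : ∀ u : Sym2 (Fin n) → unitInterval, IsProbabilityMeasure (prodBernoulli u) := fun u => inferInstance
  have hcs : c ≠ s₂ := fun h => hs₂A (h ▸ hcA)
  have hds : d ≠ s₂ := fun h => hs₂A (h ▸ hdA)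
  have hi1 : i ≠ s₁ := fun h => hs₁A (h ▸ hiA)
  have hc1 : c ≠ s₁ := fun h => hs₁A (h ▸ hcA)
  have hd1 : d ≠ s₁ := fun h => hs₁A (h ▸ hdA)
  have hne : s(s₂, c) ≠ s(s₂, d) := fun h => hcd (Sym2.congr_right.1 h)
  have hYmem : (w s(s₂, c) : ℝ) * w s(s₂, d) ∈ unitInterval := unitInterval.mul_mem (w s(s₂, c)).2 (w s(s₂, d)).2
  -- the glued weight function `u = w[s₂c ↦ 1, s₂d ↦ Y]`
  set u : Sym2 (Fin n) → unitInterval :=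
    Function.update (Function.update w s(s₂, c) 1) s(s₂, d) ⟨(w s(s₂, c) : ℝ) * w s(s₂, d), hYmem⟩ with hu
  have hu_ed : u s(s₂, d) = ⟨(w s(s₂, c) : ℝ) * w s(s₂, d), hYmem⟩ := by rw [hu, Function.update_self]
  have hu_ec : u s(s₂, c) = 1 := by rw [hu, Function.update_of_ne hne, Function.update_self]
  have hu_ne : ∀ e : Sym2 (Fin n), e ≠ s(s₂, c) → e ≠ s(s₂, d) → u e = w e := fun e h1 h2 => by
    rw [hu, Function.update_of_ne h2, Function.update_of_ne h1]
  have hu_off : ∀ e : Sym2 (Fin n), s₂ ∉ e → u e = w e :=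
    fun e he => hu_ne e (fun h => he (h ▸ Sym2.mem_mk_left s₂ c)) (fun h => he (h ▸ Sym2.mem_mk_left s₂ d))
  have hobs_u : ∀ y, y ≠ s₂ → u s(s₂, y) ≠ 0 → y = c ∨ y = d := by
    intro y hy h
    by_cases hyc : y = c
    · exact Or.inl hyc
    by_cases hyd : y = d
    · exact Or.inr hyd
    rw [hu_ne _ (fun h' => hyc (Sym2.congr_right.1 h')) (fun h' => hyd (Sym2.congr_right.1 h'))] at h
    exact hobs₂ y hy h
  have hY : ((u s(s₂, d) : unitInterval) : ℝ) = (w s(s₂, c) : ℝ) * w s(s₂, d) := by rw [hu_ed]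
  have hglue : (u s(s₂, c) : ℝ) * u s(s₂, d) = (w s(s₂, c) : ℝ) * w s(s₂, d) := by
    rw [hu_ec, hY, Set.Icc.coe_one, one_mul]
  have hsame : ∀ x ∈ A, (prodBernoulli u).real {ω : BondConfig (Fin n) | (A.filter fun z => ω ∈ openConn x z).card ≤ j} =
      (prodBernoulli w).real {ω : BondConfig (Fin n) | (A.filter fun z => ω ∈ openConn x z).card ≤ j} :=
    fun x hx => lightness_eq_of_sameGlue u w A s₂ c d x j hs₂A hx hcs hds hcd hobs_u hobs₂ hu_off hglue
  -- the gates of `s₁` together with `c, d`, listed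
  set Pset : Finset (Fin n) := (A.filter fun a => w s(s₁, a) ≠ 0) ∪ {c, d} with hPset
  have hPA : Pset ⊆ A := by
    intro a ha
    rcases Finset.mem_union.1 ha with ha | ha
    · exact (Finset.mem_filter.1 ha).1
    · rcases Finset.mem_insert.1 ha with rfl | ha
      · exact hcA
      · exact (Finset.mem_singleton.1 ha) ▸ hdA
  set m : ℕ := Pset.card with hm
  let p : Fin m → Fin n := fun l => ((Pset.equivFin.symm l) : Fin n)
  have hp : Function.Injective p := by
    intro l l' h
    exact Pset.equivFin.symm.injective (Subtype.ext h)
  have hpP : ∀ l, p l ∈ Pset := fun l => (Pset.equivFin.symm l).2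
  have hpA : ∀ l, p l ∈ A := fun l => hPA (hpP l)
  have hsurj : ∀ v ∈ Pset, ∃ l, v = p l := fun v hv =>
    ⟨Pset.equivFin ⟨v, hv⟩, by show v = ((Pset.equivFin.symm (Pset.equivFin ⟨v, hv⟩)) : Fin n); rw [Equiv.symm_apply_apply]⟩
  obtain ⟨lc, hlc⟩ := hsurj c (Finset.mem_union_right _ (by simp))
  have hobs₁u : ∀ v, u s(s₁, v) ≠ 0 → ∃ l, v = p l := by
    intro v hv
    have h1 : s(s₁, v) ≠ s(s₂, c) := fun h => by
      have := Sym2.eq_iff.1 h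
      rcases this with ⟨h', -⟩ | ⟨h', -⟩
      · exact h12 h'
      · exact hc1 h'.symm
    have h2 : s(s₁, v) ≠ s(s₂, d) := fun h => by
      have := Sym2.eq_iff.1 h
      rcases this with ⟨h', -⟩ | ⟨h', -⟩
      · exact h12 h'
      · exact hd1 h'.symm
    rw [hu_ne _ h1 h2] at hv
    exact hsurj v (Finset.mem_union_left _ (Finset.mem_filter.2 ⟨hobs₁ v hv, hv⟩))
  have hdom_u : ∀ l : Fin m, (prodBernoulli u).real {ω : BondConfig (Fin n) | (A.filter fun z => ω ∈ openConn (p l) z).card ≤ j} ≤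
      (prodBernoulli u).real {ω : BondConfig (Fin n) | (A.filter fun z => ω ∈ openConn i z).card ≤ j} := by
    intro l
    rw [hsame (p l) (hpA l), hsame i hiA]
    refine hdom (p l) (hpA l) ?_
    rcases Finset.mem_union.1 (hpP l) with h | h
    · exact Or.inl (Finset.mem_filter.1 h).2
    · rcases Finset.mem_insert.1 h with h | h
      · exact Or.inr (Or.inl h)
      · exact Or.inr (Or.inr (Finset.mem_singleton.1 h))
  -- the two level-two lemmas in `u`
  have hslack := levelTwo_slack u A s₁ s₂ c d i j p hp hpA hs₁A hs₂A h12 hcd hdA hobs₁u ⟨lc, hlc.symm⟩ hobs_u hu_ec hdom_u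
  have hcomp := levelTwo_compare u A s₁ s₂ c d i j hj p hpA hs₁A hs₂A h12 hcA hdA hcd hiA hic hid hobs₁u hobs_u hu_ec
  -- `CSdiff_u({s₁}, i) = I_u(i) − μ_u{1 ≤ |π(s₁)| ≤ j}`
  have hIL : (prodBernoulli u).real {ω : BondConfig (Fin n) | (A.filter fun z => ω ∈ openConn i z).card ≤ j} -
      (prodBernoulli u).real {ω : BondConfig (Fin n) |
        1 ≤ (A.filter fun z => ω ∈ openConn s₁ z).card ∧ (A.filter fun z => ω ∈ openConn s₁ z).card ≤ j} =
      (prodBernoulli u).real {ω : BondConfig (Fin n) | ω ∉ openConn i s₁ ∧ (A.filter fun z => ω ∈ openConn i z).card ≤ j} -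
      (prodBernoulli u).real {ω : BondConfig (Fin n) | ω ∉ openConn i s₁ ∧
        1 ≤ (A.filter fun z => ω ∈ openConn s₁ z).card ∧ (A.filter fun z => ω ∈ openConn s₁ z).card ≤ j} := by
    set I := {ω : BondConfig (Fin n) | (A.filter fun z => ω ∈ openConn i z).card ≤ j} with hI
    set Ls := {ω : BondConfig (Fin n) |
      1 ≤ (A.filter fun z => ω ∈ openConn s₁ z).card ∧ (A.filter fun z => ω ∈ openConn s₁ z).card ≤ j} with hLs
    set D : Set (BondConfig (Fin n)) := openConn i s₁ with hD
    have h1 := measureReal_inter_add_sdiff (μ := prodBernoulli u) (s := I) (MeasurableSet.of_discrete (s := D))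
    have h2 := measureReal_inter_add_sdiff (μ := prodBernoulli u) (s := Ls) (MeasurableSet.of_discrete (s := D))
    have hID : I ∩ D = Ls ∩ D := by
      ext ω
      simp only [hI, hLs, hD, mem_inter_iff, mem_setOf_eq]
      constructor
      · rintro ⟨h, hω⟩
        have heq : (A.filter fun z => ω ∈ openConn s₁ z) = (A.filter fun z => ω ∈ openConn i z) :=
          Finset.filter_congr fun z _ =>
            ⟨fun hz => SimpleGraph.Reachable.trans hω hz, fun hz => SimpleGraph.Reachable.trans (SimpleGraph.Reachable.symm hω) hz⟩
        refine ⟨⟨?_, by rw [heq]; exact h⟩, hω⟩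
        rw [heq]
        exact Finset.card_pos.2 ⟨i, Finset.mem_filter.2 ⟨hiA, SimpleGraph.Reachable.refl _⟩⟩
      · rintro ⟨⟨-, h⟩, hω⟩
        have heq : (A.filter fun z => ω ∈ openConn s₁ z) = (A.filter fun z => ω ∈ openConn i z) :=
          Finset.filter_congr fun z _ =>
            ⟨fun hz => SimpleGraph.Reachable.trans hω hz, fun hz => SimpleGraph.Reachable.trans (SimpleGraph.Reachable.symm hω) hz⟩
        exact ⟨by rw [← heq]; exact h, hω⟩
    have hI' : I \ D = {ω : BondConfig (Fin n) | ω ∉ openConn i s₁ ∧ (A.filter fun z => ω ∈ openConn i z).card ≤ j} := by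
      ext ω; simp only [hI, hD, mem_sdiff, mem_setOf_eq]; tauto
    have hL' : Ls \ D = {ω : BondConfig (Fin n) | ω ∉ openConn i s₁ ∧
        1 ≤ (A.filter fun z => ω ∈ openConn s₁ z).card ∧ (A.filter fun z => ω ∈ openConn s₁ z).card ≤ j} := by
      ext ω; simp only [hLs, hD, mem_sdiff, mem_setOf_eq]; tauto
    rw [← hI', ← hL']
    rw [hID] at h1
    linarith
  -- the hyperedge inequality in `u`, then moved to `w`
  have hDDu : 0 ≤ (1 - (u s(s₂, d) : ℝ)) *
        ((prodBernoulli u).real {ω : BondConfig (Fin n) |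
            (∀ y ∈ ({s₁} : Finset (Fin n)), ¬ (openGraph (ω ∩ {e | s₂ ∉ e})).Reachable i y) ∧
              (A.filter fun z => (openGraph (ω ∩ {e | s₂ ∉ e})).Reachable i z).card ≤ j} -
          (prodBernoulli u).real {ω : BondConfig (Fin n) |
            (∀ y ∈ ({s₁} : Finset (Fin n)), ¬ (openGraph (ω ∩ {e | s₂ ∉ e})).Reachable i y) ∧
              1 ≤ (A.filter fun z => ∃ y ∈ ({s₁} : Finset (Fin n)), (openGraph (ω ∩ {e | s₂ ∉ e})).Reachable y z).card ∧
              (A.filter fun z => ∃ y ∈ ({s₁} : Finset (Fin n)), (openGraph (ω ∩ {e | s₂ ∉ e})).Reachable y z).card ≤ j}) +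
      (u s(s₂, d) : ℝ) *
        ((prodBernoulli u).real {ω : BondConfig (Fin n) |
            (∀ y ∈ ({s₁} ∪ {c, d} : Finset (Fin n)), ¬ (openGraph (ω ∩ {e | s₂ ∉ e})).Reachable i y) ∧
              (A.filter fun z => (openGraph (ω ∩ {e | s₂ ∉ e})).Reachable i z).card ≤ j} -
          (prodBernoulli u).real {ω : BondConfig (Fin n) |
            (∀ y ∈ ({s₁} ∪ {c, d} : Finset (Fin n)), ¬ (openGraph (ω ∩ {e | s₂ ∉ e})).Reachable i y) ∧
              1 ≤ (A.filter fun z => ∃ y ∈ ({s₁} ∪ {c, d} : Finset (Fin n)), (openGraph (ω ∩ {e | s₂ ∉ e})).Reachable y z).card ∧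
              (A.filter fun z => ∃ y ∈ ({s₁} ∪ {c, d} : Finset (Fin n)),
                (openGraph (ω ∩ {e | s₂ ∉ e})).Reachable y z).card ≤ j}) := by
    have hnn : 0 ≤ (u s(s₂, d) : ℝ) * ((prodBernoulli u).real {ω : BondConfig (Fin n) | ∀ l, s(s₁, p l) ∉ ω} *
        (prodBernoulli u).real {ω : BondConfig (Fin n) |
          (A.filter fun z => (openGraph ((ω ∩ {e | s₁ ∉ e}) ∩ {e | s₂ ∉ e})).Reachable c z ∨
            (openGraph ((ω ∩ {e | s₁ ∉ e}) ∩ {e | s₂ ∉ e})).Reachable d z).card ≤ j}) :=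
      mul_nonneg (u s(s₂, d)).2.1 (mul_nonneg measureReal_nonneg measureReal_nonneg)
    nlinarith [hslack, hcomp, hIL, hnn]
  -- transfer the off-`s₂` terms from `u` to `w`
  have hwoff : (fun e => if e ∈ {e : Sym2 (Fin n) | s₂ ∉ e} then u e else 0) =
      (fun e => if e ∈ {e : Sym2 (Fin n) | s₂ ∉ e} then w e else 0) := by
    funext e
    by_cases he : s₂ ∉ e
    · simp only [mem_setOf_eq, he, not_false_eq_true, if_true, hu_off e he]
    · simp only [mem_setOf_eq, he, if_false]
  have htr : ∀ S : Set (BondConfig (Fin n)), (prodBernoulli u).real {ω | ω ∩ {e | s₂ ∉ e} ∈ S} =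
      (prodBernoulli w).real {ω | ω ∩ {e | s₂ ∉ e} ∈ S} := by
    intro S
    rw [measureReal_preimage_avoid u s₂ S, measureReal_preimage_avoid w s₂ S, hwoff]
  have hdomc := hdom c hcA (Or.inr (Or.inl rfl))
  have hdomd := hdom d hdA (Or.inr (Or.inr rfl))
  refine setCS_pair_of_hyperedgeDD w A s₁ s₂ c d i j hs₂A h12 hcA hdA hcd hiA hi1 hobs₂ hdomc hdomd ?_
  have e1 := htr {ξ : BondConfig (Fin n) | (∀ y ∈ ({s₁} : Finset (Fin n)), ¬ (openGraph ξ).Reachable i y) ∧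
    (A.filter fun z => (openGraph ξ).Reachable i z).card ≤ j}
  have e2 := htr {ξ : BondConfig (Fin n) | (∀ y ∈ ({s₁} : Finset (Fin n)), ¬ (openGraph ξ).Reachable i y) ∧
    1 ≤ (A.filter fun z => ∃ y ∈ ({s₁} : Finset (Fin n)), (openGraph ξ).Reachable y z).card ∧
    (A.filter fun z => ∃ y ∈ ({s₁} : Finset (Fin n)), (openGraph ξ).Reachable y z).card ≤ j}
  have e3 := htr {ξ : BondConfig (Fin n) | (∀ y ∈ ({s₁} ∪ {c, d} : Finset (Fin n)), ¬ (openGraph ξ).Reachable i y) ∧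
    (A.filter fun z => (openGraph ξ).Reachable i z).card ≤ j}
  have e4 := htr {ξ : BondConfig (Fin n) | (∀ y ∈ ({s₁} ∪ {c, d} : Finset (Fin n)), ¬ (openGraph ξ).Reachable i y) ∧
    1 ≤ (A.filter fun z => ∃ y ∈ ({s₁} ∪ {c, d} : Finset (Fin n)), (openGraph ξ).Reachable y z).card ∧
    (A.filter fun z => ∃ y ∈ ({s₁} ∪ {c, d} : Finset (Fin n)), (openGraph ξ).Reachable y z).card ≤ j}
  simp only [mem_setOf_eq] at e1 e2 e3 e4
  rw [← e1, ← e2, ← e3, ← e4, ← hY]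
  exact hDDu

end Summit.CriticalPhenomena.PercolationContinuityZ3.Theorems

end
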